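import Summits.QuantumFields.BalabanUV.T4Continuum.Support.NE7ApeTrivialFlatEndDischarged
import HarnessLib

/-!
# NE7ApeTrivialFlatEndLinks — (APE) AT THE TRIVIAL FLAT DATUM WITH THE [B8] BINDER STATED CHART-FREE, ON THE LINKS: a unitary periodic gauge `u₀` in which
# every link of `U` is within `r₀ ≤ 1∕2` of `1` and nearest-neighbour link differences are `≤ r₁`; the representative `A₀ := log(U^{u₀})` (with `‖A₀‖ ≤ 2r₀`,
# `‖∇A₀‖ ≤ 2r₁`) is then BUILT inside, so no `vary`∕`mlog`∕`A₀` appears among the hypotheses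

Cell `pub-balaban`, rung (B)+1 sub-cell t4, lineage `b2b-balaban-t4-ne7-p1`, generation 72 (CRUX PROVER NE7 #1, OWNER row NE7).  File G7 over (155)
`NE7ApeTrivialFlatEndDischarged.smallField_of_trivialLetters_final` (t4-ne7-p2 gen 87 ∕ re-filed p393779).  WHY.  After (155) the END at the trivial flat datum
displays ONE Bałaban TYPE, [B8] Theorem 2 (i)'s output: a gauge `u₀` and a representative `A₀` with `U^{u₀} = e^{A₀}` (`gaugeAct u₀ U = vary 1 A₀ 1`), `‖A₀‖ ≤ a₀`,
`‖A₀(· + e_τ) − A₀‖ ≤ a₁`.  What NE7 needs of Theorem 2 is only the SIZE of the links in a good gauge (memo §9, REP♭⁻); this file states that binder in the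
most elementary form a future prover of REP♭ can target — LINK bounds, no chart: `‖U^{u₀}(b) − 1‖ ≤ r₀` (`r₀ ≤ 1∕2`) and `‖U^{u₀}(b + e_τ) − U^{u₀}(b)‖ ≤ r₁` —
and constructs `A₀ := mlog(U^{u₀})` itself: `e^{A₀} = U^{u₀}` (`B7Prop4Flat.expUnit_mlog`, `‖U^{u₀} − 1‖ < 1`), `A₀` periodic (`U` and `u₀` periodic,
`NE3SmoothLiftW.isPeriodicCfg_gaugeAct`), `‖A₀‖ ≤ 2r₀` (`MatrixLog.norm_mlog_le_two_mul`), `‖A₀(b + e_τ) − A₀(b)‖ ≤ (1 + r₀∕(1−r₀))·r₁ ≤ 2r₁`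
(`FederbushMean.norm_mlog_sub_mlog_le`, the Lipschitz bound of `log` on the ball `‖· − 1‖ ≤ r₀`).  So (155) applies with `a₀ := 2r₀`, `a₁ := 2r₁`.
WHAT ([folklore]; 0 def, 0 sorry; dimension `d + 1 ≥ 2`, `n : Type`).  **`smallField_of_trivialLetters_links`**: (155) `…_final` with the binders
`(A₀, hgauge₀, hA₀P, ha₀, ha₁)` REPLACED by `hUP` (periodicity of `U`, which admissible configurations have), `hr₀h : r₀ ≤ 1∕2`, `hr₀` (links of `U^{u₀}` within
`r₀` of `1`), `hr₁` (link differences `≤ r₁`); `a₀ ↦ 2r₀`, `a₁ ↦ 2r₁` in the numeric lines `hω'`, `hβ`, `hAα'`, `hA1'`; every other hypothesis and the radius verbatim.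
The sizes the bootstrap needs (memo §9): `r₀ ≲ δ∕M`, `r₁ ≲ δ∕M²` (`M = L^{k+1}`) — [B8] Theorem 2's `B₁(α₀+α₁)η`, `B₁(α₀+α₁)η²` with `η = M⁻¹`, `α₀ ∝ δ`, `α₁ = 0`.
HONEST FRAMING (page 1): bookkeeping + the elementary `log` estimates BY NAME; the link-size binder `(u₀, r₀, r₁)` IS [B8] Theorem 2 (i) TYPE — a HYPOTHESIS,
NOT proved (its `1∕M`, `1∕M²` gains over the axial gauge are the Landau gauge + regularity of pp. 83–95); tangent-criticality and the numeric lines remain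
displayed; ONE datum (the trivial one); (APE) NOT proved unconditionally; NOT ONE-STEP, NOT NE7; spine 0∕9; finite T⁴ rung (B)+1 — NOT infinite volume,
NOT mass gap, NOT Clay.  Continuum YM on T⁴ ⇐ BetaPertH ∧ nine spine estimates (0/9 proved); BetaPertH ⇐ (D1) ∧ (D4) ∧ CAP+tail; G-an2-4 gates asym,
D1 and NE2/3/4.
-/

set_option autoImplicit false

open scoped BigOperators Matrix.Norms.L2Operator
open NormedSpace Finset

namespace Summit.QuantumFields.BalabanUV.T4Continuum.NE7ApeTrivialFlatEndLinks

open Literature.MathematicalPhysics.QuantumFieldTheory.Balaban1983to89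
open B7Prop1Explicit B7Prop2Explicit MatrixLog UnitaryModel
open T4AveragingDeficitWall (IsUnitaryCfg IsSkewDir SmallField vary curlAt dirL1)
open T4AveragingDeficitWallBoundary (IsPeriodicCfg periodBox)
open AveragingDeficitPeriodicCounting (IsPeriodicDir)
open AveragingDeficitMultiLevelPrep (cavgIter LevelSmall)
open MinimalActionLevels (perWin)
open BlockAveragePushDirSplit (flat)
open BlockAverageVaryHolo (nbRad)
open BlockAverageVaryDisc (rho0)
open B4Sect5Proof (latticeConst)
open B5Hk163Strip (kappa163)
open B5Hk163TorusHolderDecay (CdecD)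
open B7Prop4Flat (expUnit_mlog)
open FederbushMean (norm_mlog_sub_mlog_le)
open NE3HessForm (hess dAction)
open NE3TangentCovariantTower (dirIter)
open NE3QbarIterCovLiftPrep (cruxC)
open NE3RightInverseSolveLetters (thetaLoc)
open NE3HatInvCurlLetters (curl1C)
open NE3EnergyShapes (IsUnitarySite)
open NE3SmoothLiftW (isPeriodicCfg_gaugeAct)
open NE7ApeTrivialFlatEndDischarged (smallField_of_trivialLetters_final)

noncomputable section

variable {d : ℕ}

/-- **(APE) AT THE TRIVIAL FLAT DATUM, [B8] BINDER ON THE LINKS**: (155) `smallField_of_trivialLetters_final` with [B8] Theorem 2 (i)'s output stated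
chart-free — a unitary `(L^{k+1}N)`-periodic gauge `u₀` with `‖U^{u₀}(y,κ) − 1‖ ≤ r₀ ≤ 1∕2` and `‖U^{u₀}(y+e_τ,κ) − U^{u₀}(y,κ)‖ ≤ r₁` for all `y, κ, τ` — and
`U` periodic; the logarithmic representative `A₀ = log U^{u₀}` (`‖A₀‖ ≤ 2r₀`, `‖∇A₀‖ ≤ 2r₁`) is constructed in the proof; numeric lines with `a₀ = 2r₀`,
`a₁ = 2r₁`; conclusion verbatim. [folklore] -/
theorem smallField_of_trivialLetters_links {n : Type} [Fintype n] [DecidableEq n] [Nonempty n] (hd : 1 ≤ d) {L : ℕ} (hL : 2 ≤ L) :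
    ∃ K : ℝ, 0 ≤ K ∧ ∀ (N : ℕ) [NeZero N] (k : ℕ)
    {U : Site (d + 1) → Fin (d + 1) → (Matrix n n ℂ)ˣ} (hU : IsUnitaryCfg U) {x δ : ℝ} (hx : 0 ≤ x) (hs : LevelSmall (d + 1) L k x)
    (hUx : SmallField U x) (hδ : 0 ≤ δ) (hUδ : SmallField U (δ / ((L : ℝ) ^ (k + 1)) ^ 2)) (hδx : δ / ((L : ℝ) ^ (k + 1)) ^ 2 ≤ x)
    (hcritU : ∀ φ : Site (d + 1) → Fin (d + 1) → Matrix n n ℂ, IsSkewDir φ → IsPeriodicDir φ ((L ^ (k + 1) * N : ℕ) : ℤ) →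
      dirIter L (k + 1) U φ = 0 → dAction U φ (perWin (d + 1) (L ^ (k + 1) * N)) = 0)
    (hflatTopU : cavgIter L (k + 1) U = flat)
    (hUP : IsPeriodicCfg U ((L ^ (k + 1) * N : ℕ) : ℤ))
    {u₀ : Site (d + 1) → (Matrix n n ℂ)ˣ} (hu₀ : IsUnitarySite u₀)
    (hu₀P : ∀ (y : Site (d + 1)) (i : Fin (d + 1)), u₀ (y + (((L ^ (k + 1) * N : ℕ) : ℤ)) • e i) = u₀ y)
    {r₀ r₁ ω : ℝ} (hr₀h : r₀ ≤ 1 / 2) (hr₀ : ∀ (y : Site (d + 1)) (κ : Fin (d + 1)), ‖((gaugeAct u₀ U y κ : (Matrix n n ℂ)ˣ) : Matrix n n ℂ) - 1‖ ≤ r₀)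
    (hr₁ : ∀ (y : Site (d + 1)) (κ τ : Fin (d + 1)),
      ‖((gaugeAct u₀ U (y + e τ) κ : (Matrix n n ℂ)ˣ) : Matrix n n ℂ) - ((gaugeAct u₀ U y κ : (Matrix n n ℂ)ˣ) : Matrix n n ℂ)‖ ≤ r₁)
    (hω' : (L : ℝ) ^ (k + 1) * (Real.exp (2 * r₀) - 1)
        + 136 * ((((d + 1 : ℕ) : ℝ) + 1) * (((d + 1 : ℕ) : ℝ) + 4)) * (((L : ℝ) ^ (k + 1)) ^ 2 * (δ / ((L : ℝ) ^ (k + 1)) ^ 2)) ≤ ω)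
    (hωd : 300 * ((d + 1 : ℕ) : ℝ) * ω ≤ 1) (hβ : Real.exp (2 * r₀) - 1 + 8 * ω / (L : ℝ) ^ (k + 1) ≤ 1 / 4)
    {α₀ α₁ αh1 : ℝ} (hAα' : 2 * (Real.exp (2 * r₀) - 1 + 8 * ω / (L : ℝ) ^ (k + 1)) ≤ α₀)
    (hA1' : 4 / 3 * (Real.exp (2 * r₀) * (2 * r₁) + 2 * (8 * ω / (L : ℝ) ^ (k + 1)) * (Real.exp (2 * r₀) - 1)
        + 165 * ω / ((L : ℝ) ^ (k + 1)) ^ 2 + (8 * ω / (L : ℝ) ^ (k + 1)) ^ 2) ≤ α₁)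
    (hα₁h : α₁ ≤ αh1 / ((L : ℝ) ^ (k + 1)) ^ 2)
    (hθ : cruxC (d + 1) L * (((L : ℝ) ^ (k + 1)) ^ 2 * x) < 1) (hθl : thetaLoc (d + 1) L * (((L : ℝ) ^ (k + 1)) ^ 2 * x) < 1)
    (hε : ((L : ℝ) ^ (k + 1)) ^ 2 * x ≤ 1)
    (hσ : 4 * (3 + 12 * ((d + 1 : ℕ) : ℝ)) ^ 2 * (L : ℝ) ^ (k + 1) * α₀ ≤ rho0 (d + 1) L ^ 2)
    (hS1 : (8 * (3 + 12 * ((d + 1 : ℕ) : ℝ)) * (2 + 2 * ((((d + 1 : ℕ) : ℝ) + 1) * L)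
        * (1 + ((1250 * ((nbRad (d + 1) L : ℝ) + L) + 8 * (((d + 1 : ℕ) : ℝ) * L) + 2 * L) * (((d + 1 : ℕ) : ℝ) * (2 * nbRad (d + 1) L + 1) ^ (d + 1)))
            / ((L : ℝ) / (L : ℝ) ^ (d + 1))))) * ((L : ℝ) ^ (k + 1) * α₀) ≤ 1)
    (hb : 256 * (((d + 1 : ℕ) : ℝ) + 1) * L * (3 + 12 * ((d + 1 : ℕ) : ℝ)) * ((L : ℝ) ^ (k + 1) * α₀) ≤ 1),
    SmallField U
      ((K * (2 * (curl1C (d + 1) L / (1 - thetaLoc (d + 1) L * (((L : ℝ) ^ (k + 1)) ^ 2 * x)))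
                * (8 * (3 + 12 * ((d + 1 : ℕ) : ℝ)) * (2 + 2 * ((((d + 1 : ℕ) : ℝ) + 1) * L)
                  * (1 + ((1250 * ((nbRad (d + 1) L : ℝ) + L) + 8 * (((d + 1 : ℕ) : ℝ) * L) + 2 * L)
                      * (((d + 1 : ℕ) : ℝ) * (2 * nbRad (d + 1) L + 1) ^ (d + 1))) / ((L : ℝ) / (L : ℝ) ^ (d + 1)))))
                * δ * ((L : ℝ) ^ (k + 1) * α₀)
              + (Fintype.card (T4AveragingDeficitWall.Plane (d + 1)) : ℝ)
                * (144 * (((L : ℝ) ^ (k + 1) * α₀) * αh1) + 5440 * ((L : ℝ) ^ (k + 1) * α₀) ^ 3 + 8 * (αh1 * αh1)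
                    + 304 * (αh1 * ((L : ℝ) ^ (k + 1) * α₀) ^ 2) + 2688 * ((L : ℝ) ^ (k + 1) * α₀) ^ 4))
          + Fintype.card n * (2 * (CdecD d * (((d : ℝ) + 1) * (2 * ((d : ℝ) + 1))
              * ((2 + 32 / (kappa163 (d + 1) / (d + 1)) ^ 2) * latticeConst (d + 1) (kappa163 (d + 1) / (d + 1) / 2)))))
            * (0 + 28 * ((3 + 12 * ((d + 1 : ℕ) : ℝ)) * ((L : ℝ) ^ (k + 1) * α₀)
                  + 4 * (3 + 12 * ((d + 1 : ℕ) : ℝ)) ^ 3 / rho0 (d + 1) L ^ 2 * ((L : ℝ) ^ (k + 1) * α₀) ^ 2) ^ 2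
                + 4 * (4 * (3 + 12 * ((d + 1 : ℕ) : ℝ)) ^ 3 / rho0 (d + 1) L ^ 2 * ((L : ℝ) ^ (k + 1) * α₀) ^ 2))
          + 28 * ((L : ℝ) ^ (k + 1) * α₀) ^ 2)
        / ((L : ℝ) ^ (k + 1)) ^ 2) := by
  obtain ⟨K, hK, h⟩ := smallField_of_trivialLetters_final (n := n) hd hL
  refine ⟨K, hK, ?_⟩
  intro N _ k U hU x δ hx hs hUx hδ hUδ hδx hcritU hflatTopU hUP u₀ hu₀ hu₀P r₀ r₁ ω hr₀h hr₀ hr₁ hω' hωd hβ α₀ α₁ αh1 hAα' hA1'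
    hα₁h hθ hθl hε hσ hS1 hb
  -- the logarithmic representative `A₀ := log (U^{u₀})` of the gauged configuration, bondwise
  have hlt : ∀ (y : Site (d + 1)) (κ : Fin (d + 1)), ‖((gaugeAct u₀ U y κ : (Matrix n n ℂ)ˣ) : Matrix n n ℂ) - 1‖ < 1 := fun y κ =>
    (hr₀ y κ).trans_lt (by linarith)
  have hgauge₀ : gaugeAct u₀ U
      = vary (flat (d := d + 1) (n := n)) (fun y κ => mlog ((gaugeAct u₀ U y κ : (Matrix n n ℂ)ˣ) : Matrix n n ℂ)) 1 := by
    funext y κ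
    unfold vary
    rw [Complex.ofReal_one, one_smul, expUnit_mlog (hlt y κ)]
    exact (one_mul _).symm
  have hVP : IsPeriodicCfg (gaugeAct u₀ U) ((L ^ (k + 1) * N : ℕ) : ℤ) := isPeriodicCfg_gaugeAct hu₀P hUP
  have hA₀P : IsPeriodicDir (fun y κ => mlog ((gaugeAct u₀ U y κ : (Matrix n n ℂ)ˣ) : Matrix n n ℂ)) ((L ^ (k + 1) * N : ℕ) : ℤ) :=
    fun y κ μ => by dsimp only; rw [hVP y κ μ]
  have ha₀ : ∀ (y : Site (d + 1)) (κ : Fin (d + 1)), ‖mlog ((gaugeAct u₀ U y κ : (Matrix n n ℂ)ˣ) : Matrix n n ℂ)‖ ≤ 2 * r₀ := fun y κ =>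
    (norm_mlog_le_two_mul ((hr₀ y κ).trans hr₀h)).trans (by linarith [hr₀ y κ])
  have hρ : 1 + r₀ / (1 - r₀) ≤ 2 := by
    have := div_le_one_of_le₀ (show r₀ ≤ 1 - r₀ by linarith) (by linarith)
    linarith
  have ha₁ : ∀ (y : Site (d + 1)) (κ τ : Fin (d + 1)),
      ‖mlog ((gaugeAct u₀ U (y + e τ) κ : (Matrix n n ℂ)ˣ) : Matrix n n ℂ) - mlog ((gaugeAct u₀ U y κ : (Matrix n n ℂ)ˣ) : Matrix n n ℂ)‖
        ≤ 2 * r₁ := fun y κ τ =>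
    (norm_mlog_sub_mlog_le (ρ := r₀) (by linarith) (hr₀ (y + e τ) κ) (hr₀ y κ)).trans
      (mul_le_mul hρ (hr₁ y κ τ) (norm_nonneg _) (by norm_num))
  exact h N k hU hx hs hUx hδ hUδ hδx hcritU hflatTopU hu₀ hu₀P hgauge₀ hA₀P ha₀ ha₁ hω' hωd hβ hAα' hA1' hα₁h hθ hθl hε hσ hS1 hb

end

end Summit.QuantumFields.BalabanUV.T4Continuum.NE7ApeTrivialFlatEndLinks
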